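import Literature.NumberTheory.EllipticCurves.Agboola2007.RestrictedSelmerGroups
import Literature.NumberTheory.EllipticCurves.IwasawaSelmerProofs
import Literature.NumberTheory.EllipticCurves.FineSelmerCoefficientMapProofs
import HarnessLib

/-!
# Crux `PrintCf2.SplitBadTwoRankOneOfFacts` (stmt-BirchSwinnertonDyer-20368), road α — brick B5 (file 1 of 2):
# the BOTTOM-SELMER COMPARISON SKELETON for a PAIR of restricted Selmer groups — lattice level, over `L = K̄^H`

Cell `bsd-print-cf2`, width seat `bsd-line-cf2-p1-w7` g0 (planner WIDTH BRICK MENU 2026-08-28T16:11:50Z, brick B5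
«bottom-Selmer comparison skeleton … the two local terms at `𝔭₀`, `𝔭̄₀` left as NAMED abstract indices (snake-lemma
level, no local computation)»); `--supports stmt-BirchSwinnertonDyer-20368` (helper, Theses-free). HONEST FRAMING:
nothing here closes a crux or a stub; BSD is not proved by any of this; no summit statement is proved by this seat.
No definition, no named fact, no `sorry`. File 2 (`…RestrictedSelmerPairBase`) specialises to the bottom `L = K`,
adds functoriality in the coefficients and the CM instance `M = ↥((W.baseChange K₀).endEigenPrimaryTorsion 2 π r)`.

SETTING. `K` a number field, `H ≤ Γ_K` normal with fixed field `L = K̄^H`, `M` a discrete `Γ_K`-module, `p : ℕ`,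
`v`, `v̄` two finite places (intended: the two places above a split `p`; road α: `K = K₀ = ℚ(√−7)`, `p = 2 = 𝔭₀𝔭̄₀`,
`M = W* = E[𝔭̄₀^∞]`). Everything happens in ONE ambient group `H¹(H, M) = subgroupH1 H M`, which holds, for every
place `𝔮`, AGBOOLA'S `𝔮`-RESTRICTED SELMER GROUP `𝔖_𝔮(L, M) = Agboola2007.restrictedSelmer H M p 𝔮` (p645913:
STRICT = locally zero above `𝔮`, NO condition above the other places over `p`, locally trivial at the finite places
`∤ p` and at infinity; Agboola 2007 §3 = Castella 2018 Def. 2.2 with `Σ = ∅`). For the CM summand `W* = E[𝔭*^∞]`: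
* `𝔖_𝔭(L, W*)` — strict at `𝔭`, relaxed at `𝔭*`: the GREENBERG SHAPE OF THE CLASSICAL SELMER GROUP of the summand
  (Agboola §3: "`H¹_f(F_v, W*) = 0` if `v ∤ 𝔭*`"; above `𝔭*` the ordinary line of `E[p^∞]` is `W*` itself, so the
  Greenberg condition on the summand is vacuous there); it sits between the doubly-strict group and Greenberg's
  `Sel(L, W*)` for the data "strict at `𝔭`, relaxed elsewhere" (`selmerGroupOver H M p (bdpData M p 𝔭)`, INERTIA
  condition at `𝔭`), §3;
* `𝔖_{𝔭*}(L, W*)` — strict at `𝔭*`, relaxed at `𝔭`: Agboola's REVERSED group ("defined by reversing the Selmer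
  conditions above `𝔭` and `𝔭*`", §1 p. 2), the bottom object of road α's S3b / Agboola Thm. 3.1.

WHAT IS PROVED (every "local term" is an explicit IMAGE in an explicit local cohomology group of the tree; NO local
computation — the values are bricks B2/B7 of the menu):
* §0 `strictKer_strictDatum_eq_awayKer`, `mem_greenbergKer_strictDatum_iff`, `mem_restrictedSelmer_iff_resOfLe`:
  Agboola's strict condition at `𝔮` IS "the restriction `H¹(H, M) → H¹(H ⊓ D_𝔮, M)` vanishes" (`awayKer`; the datum
  `M⁺ = 0` is the tree's `fineLocalDatum`), and Greenberg's inertia condition for the same datum is "the restriction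
  to `H ⊓ I_𝔮` vanishes" — so all local terms are plain RESTRICTION maps `loc_𝔮 = resOfLe M (H ⊓ D_𝔮 ≤ H)`;
* §1 `restrictedSelmer_inf_comm_eq_iInf`, `restrictedSelmer_inf_eq_strictSelmerGroupOver`: the pair meets in the
  doubly-strict group `𝔖_v ⊓ 𝔖_v̄` = `𝔖_v̄` cut by the condition at `v` alone = Greenberg's strict Selmer group of the
  ALL-STRICT data when `v`, `v̄` are the places above `p` (Agboola's `Sel_str`);
* §2 `ker_localTerm`, `ker_localTerm_comp_subtype`, `card_restrictedSelmer_eq_card_inf_mul_card_localTerm`,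
  `card_mul_card_localTerm_comm`: the LOCAL TERM AT `v`, `Λ_v = (loc_v ∘ conj_σ)_{σ ∈ Γ_K}` (all places of `L` above
  `v`), restricted to `𝔖_v̄` has kernel EXACTLY `𝔖_v ⊓ 𝔖_v̄` (first isomorphism theorem: `𝔖_v̄ ⧸ (𝔖_v ⊓ 𝔖_v̄) ≅
  Λ_v(𝔖_v̄)`) and `#𝔖_v̄ = #(𝔖_v ⊓ 𝔖_v̄) · #Λ_v(𝔖_v̄)`; symmetrically at `v̄`; hence the COMPARISON IDENTITY
  `#𝔖_v̄ · #Λ_v̄(𝔖_v) = #𝔖_v · #Λ_v(𝔖_v̄)` (`Nat.card`, junk value `0` for infinite groups);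
* §3 `restrictedSelmer_le_selmerGroupOver_bdpData`, `selmerGroupOver_bdpData_inf_eq_restrictedSelmer`,
  `resOfLe_inertia_conjH1_eq_zero_of_mem_selmerGroupOver`, `card_selmerGroupOver_bdpData_eq`: Greenberg's `Sel(L, M)`
  for `bdpData M p v` contains `𝔖_v`, is cut back to `𝔖_v` by the same `Λ_v`, on it `Λ_v` takes values in the
  UNRAMIFIED classes `ker (H¹(H ⊓ D_v, M) → H¹(H ⊓ I_v, M))`, and `#Sel = #𝔖_v · #Λ_v(Sel)` — the third abstract index.

NOT PROVED HERE (the two named inputs the skeleton leaves open, said up front in the CLAIM on HOME/STATUS):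
(a) the KUMMER identification of `𝔖_𝔭(K₀, W*)` / Greenberg's `Sel(K₀, W*)` with the `W*`-part of the classical
Selmer group `WeierstrassCurve.selmerGroupOver` of `W/K₀` (local Kummer theory at the additive prime `2`; Greenberg
LNM 1716 Prop. 2.4 is stated for good ordinary primes) — bricks B2/B7; (b) the VALUES of the local terms and the
Poitou–Tate comparison `#𝔖_{𝔭*}(K, W*) ↔ #Ш(E/K)[𝔭*^∞] · ∏ local indices` (Agboola 2007 Thm. 2 / Prop. 8.1; global
duality is not in the tree). presearch: not applicable (no stub, no fact filed; textbook functoriality of `H¹`: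
Greenberg 1989 §1, Neukirch–Schmidt–Wingberg I §5–6, Agboola 2007 §3).

References: A. Agboola, Compositio Math. 143 (2007) = arXiv:math/0602192, §1 p. 2, §3, §6 [Agboola2007]; R. Greenberg,
Adv. Stud. Pure Math. 17 (1989) §1 p. 98 [Greenberg1989]; F. Castella, Camb. J. Math. 6 (2018) Def. 2.2 [Castella2018];
J. Neukirch, A. Schmidt, K. Wingberg, *Cohomology of Number Fields* (2008) I §5–6 [NeukirchSchmidtWingberg2008].
-/


noncomputable section

open scoped Classical

set_option linter.dupNamespace false
set_option autoImplicit false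

open NumberField IsDedekindDomain Field
open Literature.NumberTheory.EllipticCurves Literature.NumberTheory.EllipticCurves.GreenbergSelmer
open Literature.NumberTheory.EllipticCurves.Castella2018.AcSelmer
open Literature.NumberTheory.EllipticCurves.Agboola2007
open Literature.NumberTheory.GaloisRepresentations

universe u

namespace Summit.BirchSwinnertonDyer.BirchSwinnertonDyer.Theorems.PrintCf2.RestrictedSelmerPair

/-! ## §0. Agboola's strict condition at `𝔮` is "the restriction to `H ⊓ D_𝔮` vanishes" -/

section Strict

variable {K : Type u} [Field K] [NumberField K]
  (H : Subgroup (absoluteGaloisGroup K)) (M : Type u) [AddCommGroup M]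
  [DistribMulAction (absoluteGaloisGroup K) M] [TopologicalSpace M] [DiscreteTopology M]
  (v : HeightOneSpectrum (𝓞 K))

omit [TopologicalSpace M] [DiscreteTopology M] in
/-- Castella's strict datum `M⁺_v = 0` (the datum of Agboola's condition "locally zero above `𝔮`") IS the tree's
fine datum `fineLocalDatum M v` (same structure: `plus = ⊥`). [cite: Greenberg1989, §1 p. 98 ("strict")]
[cite: Castella2018, Def. 2.2 (arXiv:1704.06608 p. 5)] -/
theorem strictDatum_eq_fineLocalDatum : strictDatum M v = fineLocalDatum M v := rfl

/-- **Agboola's strict condition at `v` is local triviality at the place of `L` above `v`**: the kernel of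
the strict map for the datum `M⁺_v = 0` (classes dying in `H¹(H ⊓ D_v, M ⧸ 0)`) is the kernel `awayKer H M v` of the
restriction `H¹(H, M) → H¹(H ⊓ D_v, M)` (`M → M ⧸ 0` is an equivariant isomorphism; the tree's
`mem_strictKer_fineLocalDatum_iff`). Agboola §3: "`loc_v(c) = 0` for all `v` dividing `𝔮`".
[cite: Agboola2007, §3 (arXiv p0008:L58–64)] [cite: Greenberg1989, §1 p. 98 ("strict")] -/
theorem strictKer_strictDatum_eq_awayKer : (strictDatum M v).strictKer H = awayKer H M v := by
  ext c
  rw [strictDatum_eq_fineLocalDatum, FineSelmerCoefficientMap.mem_strictKer_fineLocalDatum_iff,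
    awayKer, AddMonoidHom.mem_ker]

/-- **Greenberg's (inertia) condition for the datum `M⁺_v = 0` is "the restriction to `H ⊓ I_v` vanishes"**:
a class dies in `H¹(H ⊓ I_v, M ⧸ 0)` iff its restriction to `H ⊓ I_v` with coefficients in `M` vanishes (a
cocycle is principal modulo `0` iff it is principal; same argument as the tree's
`mem_strictKer_fineLocalDatum_iff`, with the inertia group in place of the decomposition group).
[cite: Greenberg1989, §1 p. 98 (4)] -/
theorem mem_greenbergKer_strictDatum_iff (c : subgroupH1 H M) :
    c ∈ (strictDatum M v).greenbergKer H ↔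
      resOfLe M (inf_le_left : H ⊓ inertia v ≤ H) c = 0 := by
  obtain ⟨φ, rfl⟩ := oneCocycleClass_surjective _ c
  rw [LocalDatum.mem_greenbergKer_iff, LocalDatum.greenbergMap, resH1Hom_oneCocycleClass,
    oneCocycleClass_eq_zero_iff, resOfLe, resH1Hom_oneCocycleClass, oneCocycleClass_eq_zero_iff]
  constructor
  · rintro ⟨tbar, htbar⟩
    obtain ⟨t, rfl⟩ := (strictDatum M v).grMk_surjective tbar
    refine ⟨t, fun g ↦ ?_⟩
    have hg := Subgroup.mem_inf.1 g.2
    have h1 := htbar ⟨⟨(g : absoluteGaloisGroup K), inertia_le_decomp v hg.2⟩,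
      (mem_inertiaIn_iff H v _).2 ⟨hg.1, hg.2⟩⟩
    have h2 : (strictDatum M v).grMk (φ.1 ⟨g, hg.1⟩) =
        (strictDatum M v).grMk ((g : absoluteGaloisGroup K) • t - t) := by
      rw [map_sub]
      exact h1
    rw [← sub_eq_zero, ← map_sub, ← AddMonoidHom.mem_ker, LocalDatum.ker_grMk,
      show (strictDatum M v).plus = ⊥ from rfl, AddSubgroup.mem_bot, sub_eq_zero] at h2
    exact h2
  · rintro ⟨t, ht⟩
    refine ⟨(strictDatum M v).grMk t, fun g ↦ ?_⟩
    have hgI : ((g : decomp (K := K) v) : absoluteGaloisGroup K) ∈ inertia v :=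
      ((mem_inertiaIn_iff H v _).1 g.2).2
    have hgH : ((g : decomp (K := K) v) : absoluteGaloisGroup K) ∈ H := ((mem_inertiaIn_iff H v _).1 g.2).1
    have h1 := ht ⟨((g : decomp (K := K) v) : absoluteGaloisGroup K), Subgroup.mem_inf.2 ⟨hgH, hgI⟩⟩
    change (strictDatum M v).grMk (φ.1 (inertiaInToH H v g)) =
      (g : decomp (K := K) v) • (strictDatum M v).grMk t - (strictDatum M v).grMk t
    rw [LocalDatum.smul_grMk, ← map_sub]
    exact congrArg _ h1

/-- **Membership in `𝔖_𝔮(L, M)` with every condition a vanishing RESTRICTION**: `c ∈ 𝔖_𝔮(L, M)` iff for every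
`σ ∈ Γ_K` the conjugate `conj_σ c` restricts to zero on `H ⊓ D_w` for every finite `w ∤ p` AND for `w = 𝔮`, and on
`H ⊓ D_w` for every infinite `w`; nothing at the other places above `p` ("relaxed").
[cite: Agboola2007, §3 (arXiv p0008:L28–68)] -/
theorem mem_restrictedSelmer_iff_resOfLe [H.Normal] (p : ℕ) (𝔮 : HeightOneSpectrum (𝓞 K))
    (c : subgroupH1 H M) :
    c ∈ restrictedSelmer H M p 𝔮 ↔
      (∀ w : HeightOneSpectrum (𝓞 K), ((p : ℕ) : 𝓞 K) ∉ w.asIdeal → ∀ σ : absoluteGaloisGroup K,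
          resOfLe M (inf_le_left : H ⊓ decomp w ≤ H) (conjH1 H M σ c) = 0) ∧
        (∀ (w : InfinitePlace K) (σ : absoluteGaloisGroup K),
          resOfLe M (inf_le_left : H ⊓ decompInf w ≤ H) (conjH1 H M σ c) = 0) ∧
        ∀ σ : absoluteGaloisGroup K,
          resOfLe M (inf_le_left : H ⊓ decomp 𝔮 ≤ H) (conjH1 H M σ c) = 0 := by
  rw [mem_restrictedSelmer_iff, strictKer_strictDatum_eq_awayKer]
  rfl

end Strict

/-! ## §1. The pair `𝔖_v`, `𝔖_v̄` and the doubly-strict group `𝔖_v ⊓ 𝔖_v̄` -/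

section Pair

variable {K : Type u} [Field K] [NumberField K]
  (H : Subgroup (absoluteGaloisGroup K)) [H.Normal] (M : Type u) [AddCommGroup M]
  [DistribMulAction (absoluteGaloisGroup K) M] [TopologicalSpace M] [DiscreteTopology M]
  (p : ℕ) (v vbar : HeightOneSpectrum (𝓞 K))

/-- **The doubly-strict group is `𝔖_v̄` cut by the local condition at `v` alone.** `𝔖_v̄` imposes no condition
above `v` ("relaxed") and the same conditions as `𝔖_v` away from `p` and at infinity, so
`𝔖_v̄ ⊓ 𝔖_v = 𝔖_v̄ ⊓ ⋂_σ conj_σ⁻¹(ker loc_v)`, `loc_v : H¹(H, M) → H¹(H ⊓ D_v, M)`.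
[cite: Agboola2007, §3 (arXiv p0008:L58–68)] [cite: Castella2018, Def. 2.2 (arXiv:1704.06608 p. 5)] -/
theorem restrictedSelmer_inf_comm_eq_iInf :
    restrictedSelmer H M p vbar ⊓ restrictedSelmer H M p v =
      restrictedSelmer H M p vbar ⊓
        ⨅ σ : absoluteGaloisGroup K, (awayKer H M v).comap (conjH1 H M σ) := by
  ext c
  simp only [AddSubgroup.mem_inf, AddSubgroup.mem_iInf, AddSubgroup.mem_comap]
  constructor
  · rintro ⟨hbar, hv⟩
    refine ⟨hbar, fun σ ↦ ?_⟩
    rw [← strictKer_strictDatum_eq_awayKer]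
    exact ((mem_restrictedSelmer_iff c).1 hv).2.2 σ
  · rintro ⟨hbar, hv⟩
    have h := (mem_restrictedSelmer_iff c).1 hbar
    refine ⟨hbar, (mem_restrictedSelmer_iff c).2 ⟨h.1, h.2.1, fun σ ↦ ?_⟩⟩
    rw [strictKer_strictDatum_eq_awayKer]
    exact hv σ

/-- **`𝔖_v ⊓ 𝔖_v̄` is Greenberg's strict Selmer group for the ALL-STRICT data** when `v` and `v̄` are the places of
`K` above `p` (a split `p` in an imaginary quadratic field): locally zero above both, locally trivial away from `p`
and at infinity — Agboola's `Sel_str(F, M)` for a module with `H¹_f = 0` away from one prime, Greenberg's "strict"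
group. [cite: Agboola2007, §3 (arXiv p0008:L50–56, "the strict Selmer group")] [cite: Greenberg1989, §1 p. 98 ("strict")] -/
theorem restrictedSelmer_inf_eq_strictSelmerGroupOver
    (hv : ((p : ℕ) : 𝓞 K) ∈ v.asIdeal) (hvbar : ((p : ℕ) : 𝓞 K) ∈ vbar.asIdeal)
    (hall : ∀ w : HeightOneSpectrum (𝓞 K), ((p : ℕ) : 𝓞 K) ∈ w.asIdeal → w = v ∨ w = vbar) :
    restrictedSelmer H M p v ⊓ restrictedSelmer H M p vbar =
      strictSelmerGroupOver H M p (fun w _ ↦ strictDatum M w) := by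
  ext c
  rw [AddSubgroup.mem_inf, mem_restrictedSelmer_iff, mem_restrictedSelmer_iff,
    mem_strictSelmerGroupOver_iff]
  constructor
  · rintro ⟨⟨haway, hinf, hsv⟩, ⟨-, -, hsvbar⟩⟩
    refine ⟨haway, hinf, fun w hw σ ↦ ?_⟩
    rcases hall w hw with rfl | rfl
    · exact hsv σ
    · exact hsvbar σ
  · rintro ⟨haway, hinf, hstr⟩
    exact ⟨⟨haway, hinf, fun σ ↦ hstr v hv σ⟩, ⟨haway, hinf, fun σ ↦ hstr vbar hvbar σ⟩⟩

/-! ## §2. The local term `Λ_v = ∏_σ loc_v ∘ conj_σ` on `𝔖_v̄`: kernel, first isomorphism theorem, cardinalities -/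

/-- **The kernel of the local term `Λ_v = (loc_v ∘ conj_σ)_{σ ∈ Γ_K} : H¹(H, M) → ∏_σ H¹(H ⊓ D_v, M)`** (restriction
to every place of `L` above `v`) is `⋂_σ conj_σ⁻¹(ker loc_v)`. [cite: Greenberg1989, §1 p. 98 (2)–(3)]
[cite: NeukirchSchmidtWingberg2008, I.§5] -/
theorem ker_localTerm :
    (AddMonoidHom.pi fun σ : absoluteGaloisGroup K ↦
        (resOfLe M (inf_le_left : H ⊓ decomp v ≤ H)).comp (conjH1 H M σ)).ker =
      ⨅ σ : absoluteGaloisGroup K, (awayKer H M v).comap (conjH1 H M σ) := by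
  ext c
  simp only [AddMonoidHom.mem_ker, AddSubgroup.mem_iInf, AddSubgroup.mem_comap, awayKer, funext_iff,
    AddMonoidHom.pi_apply, AddMonoidHom.coe_comp, Function.comp_apply, Pi.zero_apply]

/-- **On `𝔖_v̄` the local term `Λ_v` has kernel EXACTLY the doubly-strict group `𝔖_v ⊓ 𝔖_v̄`** — so it descends to
an INJECTION `𝔖_v̄ ⧸ (𝔖_v ⊓ 𝔖_v̄) ↪ ∏_σ H¹(H ⊓ D_v, M)`: the "local term at `v`" of the skeleton is the image
`Λ_v(𝔖_v̄)`. [cite: Agboola2007, §3 (arXiv p0008:L50–68)] [cite: NeukirchSchmidtWingberg2008, I.§5] -/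
theorem ker_localTerm_comp_subtype :
    ((AddMonoidHom.pi fun σ : absoluteGaloisGroup K ↦
        (resOfLe M (inf_le_left : H ⊓ decomp v ≤ H)).comp (conjH1 H M σ)).comp
        (restrictedSelmer H M p vbar).subtype).ker =
      (restrictedSelmer H M p v ⊓ restrictedSelmer H M p vbar).addSubgroupOf
        (restrictedSelmer H M p vbar) := by
  ext c
  rw [AddMonoidHom.mem_ker, AddMonoidHom.comp_apply, ← AddMonoidHom.mem_ker, ker_localTerm,
    AddSubgroup.mem_addSubgroupOf, inf_comm (a := restrictedSelmer H M p v) (b := restrictedSelmer H M p vbar),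
    restrictedSelmer_inf_comm_eq_iInf, AddSubgroup.mem_inf, AddSubgroup.coe_subtype]
  exact ⟨fun h ↦ ⟨c.2, h⟩, fun h ↦ h.2⟩

/-- **`#𝔖_v̄ = #(𝔖_v ⊓ 𝔖_v̄) · #Λ_v(𝔖_v̄)`** (Lagrange + first isomorphism theorem for `Λ_v|_{𝔖_v̄}`; `Nat.card`, so
both sides are `0` when `𝔖_v̄` is infinite): the index of the doubly-strict group in Agboola's reversed group is the
order of the LOCAL TERM AT `v`. [cite: Agboola2007, §3 (arXiv p0008:L50–68)] -/
theorem card_restrictedSelmer_eq_card_inf_mul_card_localTerm :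
    Nat.card (restrictedSelmer H M p vbar) =
      Nat.card ↥(restrictedSelmer H M p v ⊓ restrictedSelmer H M p vbar) *
        Nat.card ((AddMonoidHom.pi fun σ : absoluteGaloisGroup K ↦
            (resOfLe M (inf_le_left : H ⊓ decomp v ≤ H)).comp (conjH1 H M σ)).comp
          (restrictedSelmer H M p vbar).subtype).range := by
  set f := (AddMonoidHom.pi fun σ : absoluteGaloisGroup K ↦
      (resOfLe M (inf_le_left : H ⊓ decomp v ≤ H)).comp (conjH1 H M σ)).comp
    (restrictedSelmer H M p vbar).subtype with hf
  rw [AddSubgroup.card_eq_card_quotient_mul_card_addSubgroup f.ker,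
    Nat.card_congr (QuotientAddGroup.quotientKerEquivRange f).toEquiv, hf, ker_localTerm_comp_subtype,
    Nat.card_congr (AddSubgroup.addSubgroupOfEquivOfLe
      (inf_le_right : restrictedSelmer H M p v ⊓ restrictedSelmer H M p vbar ≤ _)).toEquiv,
    mul_comm]

/-- **The comparison identity of the pair**: `#𝔖_v̄ · #Λ_v̄(𝔖_v) = #𝔖_v · #Λ_v(𝔖_v̄)` — the orders of Agboola's
reversed group `𝔖_v̄` and of the Greenberg-shaped group `𝔖_v` differ exactly by the ratio of the two local terms
(the two identities of `card_restrictedSelmer_eq_card_inf_mul_card_localTerm` through the common doubly-strict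
group). [cite: Agboola2007, §1 p. 2 (arXiv p0004:L5–9), §3] -/
theorem card_mul_card_localTerm_comm :
    Nat.card (restrictedSelmer H M p vbar) *
        Nat.card ((AddMonoidHom.pi fun σ : absoluteGaloisGroup K ↦
            (resOfLe M (inf_le_left : H ⊓ decomp vbar ≤ H)).comp (conjH1 H M σ)).comp
          (restrictedSelmer H M p v).subtype).range =
      Nat.card (restrictedSelmer H M p v) *
        Nat.card ((AddMonoidHom.pi fun σ : absoluteGaloisGroup K ↦
            (resOfLe M (inf_le_left : H ⊓ decomp v ≤ H)).comp (conjH1 H M σ)).comp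
          (restrictedSelmer H M p vbar).subtype).range := by
  rw [card_restrictedSelmer_eq_card_inf_mul_card_localTerm H M p v vbar,
    card_restrictedSelmer_eq_card_inf_mul_card_localTerm H M p vbar v,
    inf_comm (a := restrictedSelmer H M p vbar) (b := restrictedSelmer H M p v)]
  ring

/-! ## §3. Greenberg's `Sel(L, M)` for the data "strict at `v`, relaxed elsewhere" and its unramified local term -/

/-- **`𝔖_v(L, M) ≤ Sel(L, M)`** for Greenberg's Selmer group of the data `bdpData M p v` (strict at `v`, relaxed at
the other places above `p`; INERTIA condition at `v`): `𝔖_v` is the strict Selmer group of these data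
(`Agboola2007.restrictedSelmer_eq_strictSelmerGroupOver`) and strict ≤ Greenberg. For `M = W*`, `v = 𝔭` this
`Sel(L, W*)` is the Greenberg shape of the classical Selmer group of the summand.
[cite: Greenberg1989, §1 p. 98 ("a possibly smaller subgroup")] [cite: Agboola2007, §3 (arXiv p0008:L44–48)] -/
theorem restrictedSelmer_le_selmerGroupOver_bdpData (hv : ((p : ℕ) : 𝓞 K) ∈ v.asIdeal) :
    restrictedSelmer H M p v ≤ selmerGroupOver H M p (bdpData M p v) := by
  rw [restrictedSelmer_eq_strictSelmerGroupOver H M p hv]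
  exact strictSelmerGroupOver_le

/-- **`Sel(L, M)` cut by the local term at `v` is `𝔖_v(L, M)`**: `Sel(L, M) ⊓ ⋂_σ conj_σ⁻¹(ker loc_v) = 𝔖_v(L, M)`
(above `v` the strict condition implies Greenberg's; above the other places over `p` the data are relaxed and
both conditions are vacuous). [cite: Greenberg1989, §1 p. 98] [cite: Agboola2007, §3 (arXiv p0008:L44–68)] -/
theorem selmerGroupOver_bdpData_inf_eq_restrictedSelmer (hv : ((p : ℕ) : 𝓞 K) ∈ v.asIdeal) :
    selmerGroupOver H M p (bdpData M p v) ⊓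
        ⨅ σ : absoluteGaloisGroup K, (awayKer H M v).comap (conjH1 H M σ) =
      restrictedSelmer H M p v := by
  ext c
  simp only [AddSubgroup.mem_inf, AddSubgroup.mem_iInf, AddSubgroup.mem_comap]
  rw [mem_selmerGroupOver_iff, mem_restrictedSelmer_iff, strictKer_strictDatum_eq_awayKer]
  constructor
  · rintro ⟨⟨haway, hinf, -⟩, hsv⟩
    exact ⟨haway, hinf, hsv⟩
  · rintro ⟨haway, hinf, hsv⟩
    refine ⟨⟨haway, hinf, fun w hw σ ↦ ?_⟩, hsv⟩
    by_cases hwv : w = v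
    · subst hwv
      rw [bdpData_self p w hw]
      refine (strictDatum M w).strictKer_le_greenbergKer H ?_
      rw [strictKer_strictDatum_eq_awayKer]
      exact hsv σ
    · rw [bdpData_of_ne p v hw hwv]
      exact (relaxedDatum M w).strictKer_le_greenbergKer H
        (by rw [strictKer_relaxedDatum_eq_top]; exact AddSubgroup.mem_top _)

/-- **On `Sel(L, M)` the local term at `v` is UNRAMIFIED**: for `c ∈ Sel(L, M)` (data `bdpData M p v`) every
`loc_v (conj_σ c) ∈ H¹(H ⊓ D_v, M)` restricts to ZERO on the inertia group `H ⊓ I_v` (Greenberg's condition (4)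
for `M⁺_v = 0`, `mem_greenbergKer_strictDatum_iff`) — i.e. `Λ_v(Sel)` lies in the unramified classes
`ker (H¹(H ⊓ D_v, M) → H¹(H ⊓ I_v, M))`, the third abstract index of the skeleton.
[cite: Greenberg1989, §1 p. 98 (4)] [cite: NeukirchSchmidtWingberg2008, I.§5] -/
theorem resOfLe_inertia_conjH1_eq_zero_of_mem_selmerGroupOver (hv : ((p : ℕ) : 𝓞 K) ∈ v.asIdeal)
    {c : subgroupH1 H M} (hc : c ∈ selmerGroupOver H M p (bdpData M p v)) (σ : absoluteGaloisGroup K) :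
    resOfLe M (inf_le_inf_left H (inertia_le_decomp v) : H ⊓ inertia v ≤ H ⊓ decomp v)
        (resOfLe M (inf_le_left : H ⊓ decomp v ≤ H) (conjH1 H M σ c)) = 0 := by
  have hg : conjH1 H M σ c ∈ (bdpData M p v v hv).greenbergKer H :=
    ((mem_selmerGroupOver_iff c).1 hc).2.2 v hv σ
  rw [bdpData_self p v hv, mem_greenbergKer_strictDatum_iff] at hg
  rw [← AddMonoidHom.comp_apply, resOfLe_comp_holds]
  exact hg

/-- **On `Sel(L, M)` the local term `Λ_v` has kernel exactly `𝔖_v(L, M)`** (so `Sel ⧸ 𝔖_v ↪ Λ_v(Sel) ⊆ ∏_σ`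
unramified classes). [cite: Greenberg1989, §1 p. 98] [cite: Agboola2007, §3 (arXiv p0008:L44–68)] -/
theorem ker_localTerm_comp_subtype_selmerGroupOver (hv : ((p : ℕ) : 𝓞 K) ∈ v.asIdeal) :
    ((AddMonoidHom.pi fun σ : absoluteGaloisGroup K ↦
        (resOfLe M (inf_le_left : H ⊓ decomp v ≤ H)).comp (conjH1 H M σ)).comp
        (selmerGroupOver H M p (bdpData M p v)).subtype).ker =
      (restrictedSelmer H M p v).addSubgroupOf (selmerGroupOver H M p (bdpData M p v)) := by
  ext c
  rw [AddMonoidHom.mem_ker, AddMonoidHom.comp_apply, ← AddMonoidHom.mem_ker, ker_localTerm,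
    AddSubgroup.mem_addSubgroupOf, ← selmerGroupOver_bdpData_inf_eq_restrictedSelmer H M p v hv,
    AddSubgroup.mem_inf, AddSubgroup.coe_subtype]
  exact ⟨fun h ↦ ⟨c.2, h⟩, fun h ↦ h.2⟩

/-- **`#Sel(L, M) = #𝔖_v(L, M) · #Λ_v(Sel(L, M))`** (data `bdpData M p v`; Lagrange + first isomorphism theorem):
the index of Agboola's Greenberg-shaped group in Greenberg's Selmer group is the order of the (unramified) local
term at `v`. [cite: Greenberg1989, §1 p. 98] [cite: Agboola2007, §3] -/
theorem card_selmerGroupOver_bdpData_eq (hv : ((p : ℕ) : 𝓞 K) ∈ v.asIdeal) :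
    Nat.card (selmerGroupOver H M p (bdpData M p v)) =
      Nat.card (restrictedSelmer H M p v) *
        Nat.card ((AddMonoidHom.pi fun σ : absoluteGaloisGroup K ↦
            (resOfLe M (inf_le_left : H ⊓ decomp v ≤ H)).comp (conjH1 H M σ)).comp
          (selmerGroupOver H M p (bdpData M p v)).subtype).range := by
  set f := (AddMonoidHom.pi fun σ : absoluteGaloisGroup K ↦
      (resOfLe M (inf_le_left : H ⊓ decomp v ≤ H)).comp (conjH1 H M σ)).comp
    (selmerGroupOver H M p (bdpData M p v)).subtype with hf
  rw [AddSubgroup.card_eq_card_quotient_mul_card_addSubgroup f.ker,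
    Nat.card_congr (QuotientAddGroup.quotientKerEquivRange f).toEquiv, hf,
    ker_localTerm_comp_subtype_selmerGroupOver H M p v hv,
    Nat.card_congr (AddSubgroup.addSubgroupOfEquivOfLe
      (restrictedSelmer_le_selmerGroupOver_bdpData H M p v hv)).toEquiv,
    mul_comm]

end Pair

end Summit.BirchSwinnertonDyer.BirchSwinnertonDyer.Theorems.PrintCf2.RestrictedSelmerPair

end
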